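import Summits.Ventures.GridStability.Models.LineAngleBounds
import Summits.Ventures.GridStability.Models.NE39L
import Summits.Ventures.GridStability.Models.WSCC9LosslessLFF

/-!
# GridStability/Models/LineAngleTables — certified node-angle tables for the LFF objects «NE39L» and
# «WSCC9 lossless variant», with the λ-free explicit-level aggregates (model side)

Cell `gridfusion` (LADDER-GRIDFUSION LFF lane P1/P2, «explicit rational level» successor item of
lyap-1 p487113 / p488432), seat gridfusion-model-1 (g4). Pattern and lemmas: `Models/LineAngleBounds.lean`.

WHAT IS CERTIFIED HERE (kernel, exact rational arithmetic; the generator `gen_angles.py` only PROPOSES the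
rationals — every table is re-checked in the kernel by ONE `decide +kernel` through
`RecastData.table_le_angleOf` / `angleOf_le_table`, i.e. the five-doubling `AngleEnclosure` chains over `ℚ`):
* «NE39L» (`NE39L.data`, LFF P2 object of record, reference GEN 2 = index 0): `angleLo i ≤ θ*_i ≤ angleHi i`
  for the ten node angles `θ*_i = NE39L.data.angleOf i` (`= arccos c_i`; all `s_i ≥ 0`, `c_i > 0`), widths
  `1·10⁻⁵ … 4·10⁻⁵ rad` on the `10⁻⁵` grid (VALIDATED floats: 0.0000°, 23.5914°, 27.7432°, 27.5179°, 26.8291°, 27.6860°, 28.2506°, 25.2623°, 38.6437°, 4.4001°);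
* «WSCC9 lossless variant» (`WSCC9.postB_relL`, LFF P1 object, reference machine 1 = index 0, block-C
  circle points): the same for its three node angles (VALIDATED floats: 0.0000°, 39.9496°, 25.2903°);
* for both objects and BOTH line presentations (`RecastData.LffPair` = 90 / 6 ordered off-diagonal pairs,
  `w = C_ij/2`, lyap-1's closed-form instances p487113 / p488432; `RecastData.LffLine` = 45 / 3 unordered
  lines, `w = C_ij`): the λ-FREE aggregates an explicit closed-form level needs —
  `Σ_k w_k (cos δ*_k + δ*_k sin δ*_k) ≤ E` and `G ≤ w_k · vtGap(δ*_k)` for every line `k` — with `E`, `G`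
  EXPLICIT rationals, each ONE `decide +kernel` over the line type plus the generic real inequality. For
  lit-6's `Certificate.relativeClosedForm` (`K = c′·w`, `V(0) = −c′·Σ_k w_k (cos δ*_k + δ*_k sin δ*_k)` by
  `Certificate.V_zero`) every `c₀ < c′·(G − E)`, `c′ = 2/λ + λ/2`, is therefore an ADMISSIBLE LEVEL of
  `relativeClosedForm_well_subset_regionOfAttraction` (numbers in the docstrings below).
THREE COLUMNS. CERTIFIED: the enclosures and aggregates (statements about the typed synthetic objects'
exact data). VALIDATED: the float angles quoted. MODELLED: as the objects (NE39L: «synthetic VARIANT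
(conductances dropped, lossless REDISPATCH at the printed operating angles), not a sentence about the printed
New England system»; WSCC9L: «synthetic lossless uniform-λ VARIANT of the printed 9-bus»). No sentence of this
file says a grid is stable.
-/

noncomputable section

open Real Set
open Literature.MathematicalPhysics.PowerSystems.ClassicalModel.LosslessSystem (vtGap)
open Summit.Ventures.GridStability.Models.AngleEnclosure

namespace Summit.Ventures.GridStability.Models

/-! ## «NE39L» (10 nodes, reference GEN 2 = index 0) -/

namespace NE39L

/-- Certified LOWER node-angle table (rad, `10⁻⁵` grid; index order of record). -/
def angleLo : Fin 10 → ℚ := ![(0 : ℚ), (20587 : ℚ)/50000, (2421 : ℚ)/5000, (48027 : ℚ)/100000, (1873 : ℚ)/4000, (302 : ℚ)/625, (24653 : ℚ)/50000, (4409 : ℚ)/10000, (16861 : ℚ)/25000, (7679 : ℚ)/100000]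

/-- Certified UPPER node-angle table (rad, `10⁻⁵` grid). -/
def angleHi : Fin 10 → ℚ := ![(0 : ℚ), (1647 : ℚ)/4000, (24211 : ℚ)/50000, (48029 : ℚ)/100000, (46827 : ℚ)/100000, (24161 : ℚ)/50000, (12327 : ℚ)/25000, (11023 : ℚ)/25000, (8431 : ℚ)/12500, (48 : ℚ)/625]

/-- All `s_i ≥ 0`. -/
theorem data_s_nonneg : ∀ i : Fin 10, 0 ≤ data.s i := by decide +kernel

/-- All `c_i > 0` (acute operating point). -/
theorem data_c_pos : ∀ i : Fin 10, 0 < data.c i := by decide +kernel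

/-- The reference angle is `0`. -/
theorem angleOf_zero : data.angleOf 0 = 0 := data.angleOf_eq_zero (by decide +kernel) (by decide +kernel)

/-- **Certified lower node-angle bounds** `angleLo i ≤ θ*_i` (the ten chain tests in ONE `decide`). -/
theorem angleLo_le : ∀ i : Fin 10, ((angleLo i : ℚ) : ℝ) ≤ data.angleOf i :=
  data.table_le_angleOf data_circle.1 data_s_nonneg angleLo (by decide +kernel)

/-- **Certified upper node-angle bounds** `θ*_i ≤ angleHi i`. -/
theorem angleOf_le_angleHi : ∀ i : Fin 10, data.angleOf i ≤ ((angleHi i : ℚ) : ℝ) :=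
  data.angleOf_le_table data_circle.1 data_s_nonneg angleHi (by decide +kernel)

/-- Every line angle of the object lies in the Vu–Turitsyn window `(−π/2, π/2)` (all node angles in
`[0, π/2)`). -/
theorem abs_angleOf_sub_lt (a b : Fin 10) : |data.angleOf a - data.angleOf b| < π / 2 :=
  data.abs_angleOf_sub_lt_pi_div_two (data_s_nonneg a) (data_s_nonneg b) (data_c_pos a) (data_c_pos b)

/-! ### «NE39L»: λ-free aggregates for an explicit closed-form level -/

/-- `Σ_pairs (C_ij/2)·eqTermHi ≤ 3384761/50000` (`≈ 67.69522`; exact sum `≈ 67.6952185`) — one `decide`. -/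
theorem eqTermHi_sum_pair_le :
    (∑ k : RecastData.LffPair 9, data.Cc k.1.1 k.1.2 / 2 * data.eqTermHi angleLo angleHi k.1.1 k.1.2)
      ≤ (3384761 : ℚ) / 50000 := by
  decide +kernel

/-- `Σ_lines C_ij·eqTermHi ≤ 3384761/50000` (the same number: every line is two mirrored pairs). -/
theorem eqTermHi_sum_line_le :
    (∑ k : RecastData.LffLine 9, data.Cc k.1.1 k.1.2 * data.eqTermHi angleLo angleHi k.1.1 k.1.2)
      ≤ (3384761 : ℚ) / 50000 := by
  decide +kernel

/-- `(C_ij/2)·vtGapLo ≥ 2261/10000` on every ordered pair (minimum `≈ 0.2261048`, pair GEN 2–GEN 10,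
i.e. indices `(0, 9)`). -/
theorem vtGapLo_pair_ge : ∀ k : RecastData.LffPair 9,
    (2261 : ℚ) / 10000 ≤ data.Cc k.1.1 k.1.2 / 2 * data.vtGapLo angleLo angleHi k.1.1 k.1.2 := by
  decide +kernel

/-- `C_ij·vtGapLo ≥ 2261/5000` on every unordered line (twice the pair number). -/
theorem vtGapLo_line_ge : ∀ k : RecastData.LffLine 9,
    (2261 : ℚ) / 5000 ≤ data.Cc k.1.1 k.1.2 * data.vtGapLo angleLo angleHi k.1.1 k.1.2 := by
  decide +kernel

/-- **CERTIFIED (pairs presentation, `w = C_ij/2`):**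
`Σ_k w_k (cos δ*_k + δ*_k sin δ*_k) ≤ 3384761/50000`. -/
theorem sum_lffWo_eqTerm_le :
    ∑ k : RecastData.LffPair 9, data.lffWo k *
        (cos (RecastData.lffδso data.angleOf k)
          + RecastData.lffδso data.angleOf k * sin (RecastData.lffδso data.angleOf k))
      ≤ (3384761 : ℝ) / 50000 := by
  have h := data.sum_w_eqTerm_le_pair data_eqData data_c_pos angleLo_le angleOf_le_angleHi
    (fun k => data.Cc k.1.1 k.1.2 / 2) (fun k => by have := data_Cc_pos k.1.1 k.1.2 k.2; positivity)
  have hq := (Rat.cast_le (K := ℝ)).mpr eqTermHi_sum_pair_le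
  have e : ∀ k : RecastData.LffPair 9, data.lffWo k = ((data.Cc k.1.1 k.1.2 / 2 : ℚ) : ℝ) := fun k => by
    push_cast; rfl
  simp_rw [e]
  push_cast at h hq ⊢
  linarith

/-- **CERTIFIED (pairs presentation):** `2261/10000 ≤ w_k · vtGap(δ*_k)` on every ordered pair. -/
theorem lffWo_vtGap_ge (k : RecastData.LffPair 9) :
    (2261 : ℝ) / 10000 ≤ data.lffWo k * vtGap (RecastData.lffδso data.angleOf k) := by
  have h1 := data.vtGapLo_le_pair data_eqData data_c_pos angleLo_le angleOf_le_angleHi k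
  have h2 := (Rat.cast_le (K := ℝ)).mpr (vtGapLo_pair_ge k)
  have hw : (0 : ℝ) ≤ (data.Cc k.1.1 k.1.2 : ℝ) / 2 := by
    have := data_Cc_pos k.1.1 k.1.2 k.2; positivity
  have e : data.lffWo k = (data.Cc k.1.1 k.1.2 : ℝ) / 2 := rfl
  rw [e]
  push_cast at h2
  exact h2.trans (mul_le_mul_of_nonneg_left h1 hw)

/-- **CERTIFIED (lines presentation, `w = C_ij`):** `Σ_k w_k (cos δ*_k + δ*_k sin δ*_k) ≤ 3384761/50000`. -/
theorem sum_lffWu_eqTerm_le :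
    ∑ k : RecastData.LffLine 9, data.lffWu k *
        (cos (RecastData.lffδsu data.angleOf k)
          + RecastData.lffδsu data.angleOf k * sin (RecastData.lffδsu data.angleOf k))
      ≤ (3384761 : ℝ) / 50000 := by
  have h := data.sum_w_eqTerm_le_line data_eqData data_c_pos angleLo_le angleOf_le_angleHi
    (fun k => data.Cc k.1.1 k.1.2) (fun k => (data_Cc_pos k.1.1 k.1.2 (ne_of_lt k.2)).le)
  have hq := (Rat.cast_le (K := ℝ)).mpr eqTermHi_sum_line_le
  have e : ∀ k : RecastData.LffLine 9, data.lffWu k = ((data.Cc k.1.1 k.1.2 : ℚ) : ℝ) := fun k => rfl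
  simp_rw [e]
  push_cast at h hq ⊢
  linarith

/-- **CERTIFIED (lines presentation):** `2261/5000 ≤ w_k · vtGap(δ*_k)` on every unordered line. -/
theorem lffWu_vtGap_ge (k : RecastData.LffLine 9) :
    (2261 : ℝ) / 5000 ≤ data.lffWu k * vtGap (RecastData.lffδsu data.angleOf k) := by
  have h1 := data.vtGapLo_le_line data_eqData data_c_pos angleLo_le angleOf_le_angleHi k
  have h2 := (Rat.cast_le (K := ℝ)).mpr (vtGapLo_line_ge k)
  have hw : (0 : ℝ) ≤ (data.Cc k.1.1 k.1.2 : ℝ) := by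
    exact_mod_cast (data_Cc_pos k.1.1 k.1.2 (ne_of_lt k.2)).le
  have e : data.lffWu k = (data.Cc k.1.1 k.1.2 : ℝ) := rfl
  rw [e]
  push_cast at h2
  exact h2.trans (mul_le_mul_of_nonneg_left h1 hw)

/-- **THE EXPLICIT-LEVEL INEQUALITY, pairs** (shape of lyap-1's `hc₀` after `Certificate.V_zero`, closed
form `K = c′·w`): for every `c′ ≥ 0` and every ordered pair `k`,
`c′·(2261/10000 − 3384761/50000) ≤ −Σ_k' c′·w_k' (cos δ*_k' + δ*_k' sin δ*_k') + c′·w_k·vtGap(δ*_k)`.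
So every `c₀ < −c′ · 67.46912` is an admissible level of `NE39LLff` on `lffSystemOff`; at `λ = 1/10`
(`c′ = 401/20`): every `c₀ ≤ −1352.76`. -/
theorem closedForm_level_pair (cp : ℝ) (hcp : 0 ≤ cp) (k : RecastData.LffPair 9) :
    cp * ((2261 : ℝ) / 10000 - 3384761 / 50000)
      ≤ -(∑ k' : RecastData.LffPair 9, cp * data.lffWo k' *
            (cos (RecastData.lffδso data.angleOf k')
              + RecastData.lffδso data.angleOf k' * sin (RecastData.lffδso data.angleOf k')))
        + cp * data.lffWo k * vtGap (RecastData.lffδso data.angleOf k) := by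
  have h1 := sum_lffWo_eqTerm_le
  have h2 := lffWo_vtGap_ge k
  have e : ∑ k' : RecastData.LffPair 9, cp * data.lffWo k' *
            (cos (RecastData.lffδso data.angleOf k')
              + RecastData.lffδso data.angleOf k' * sin (RecastData.lffδso data.angleOf k'))
      = cp * ∑ k' : RecastData.LffPair 9, data.lffWo k' *
            (cos (RecastData.lffδso data.angleOf k')
              + RecastData.lffδso data.angleOf k' * sin (RecastData.lffδso data.angleOf k')) := by
    rw [Finset.mul_sum]
    exact Finset.sum_congr rfl fun _ _ => by ring
  rw [e]
  nlinarith

/-- **THE EXPLICIT-LEVEL INEQUALITY, lines** (`lffSystemU`, `w = C_ij`): for every `c′ ≥ 0` and every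
line `k`, `c′·(2261/5000 − 3384761/50000) ≤ −Σ c′·w (cos δ* + δ* sin δ*) + c′·w_k·vtGap(δ*_k)` — the
lines presentation credits the FULL line gap, so its admissible levels are higher: at `λ = 1/10` every
`c₀ ≤ −1348.23` (vs `−1352.76` for pairs; `V(0) ≥ −1357.29` in both). -/
theorem closedForm_level_line (cp : ℝ) (hcp : 0 ≤ cp) (k : RecastData.LffLine 9) :
    cp * ((2261 : ℝ) / 5000 - 3384761 / 50000)
      ≤ -(∑ k' : RecastData.LffLine 9, cp * data.lffWu k' *
            (cos (RecastData.lffδsu data.angleOf k')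
              + RecastData.lffδsu data.angleOf k' * sin (RecastData.lffδsu data.angleOf k')))
        + cp * data.lffWu k * vtGap (RecastData.lffδsu data.angleOf k) := by
  have h1 := sum_lffWu_eqTerm_le
  have h2 := lffWu_vtGap_ge k
  have e : ∑ k' : RecastData.LffLine 9, cp * data.lffWu k' *
            (cos (RecastData.lffδsu data.angleOf k')
              + RecastData.lffδsu data.angleOf k' * sin (RecastData.lffδsu data.angleOf k'))
      = cp * ∑ k' : RecastData.LffLine 9, data.lffWu k' *
            (cos (RecastData.lffδsu data.angleOf k')
              + RecastData.lffδsu data.angleOf k' * sin (RecastData.lffδsu data.angleOf k')) := by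
    rw [Finset.mul_sum]
    exact Finset.sum_congr rfl fun _ _ => by ring
  rw [e]
  nlinarith

end NE39L

/-! ## «WSCC9 lossless variant» (3 nodes, reference machine 1 = index 0) -/

namespace WSCC9

/-- Certified LOWER node-angle table of `postB_relL` (rad, `10⁻⁵` grid). -/
def angleLo : Fin 3 → ℚ := ![(0 : ℚ), (69723 : ℚ)/100000, (44139 : ℚ)/100000]

/-- Certified UPPER node-angle table of `postB_relL` (rad, `10⁻⁵` grid). -/
def angleHi : Fin 3 → ℚ := ![(0 : ℚ), (69727 : ℚ)/100000, (44141 : ℚ)/100000]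

/-- All `s_i ≥ 0`. -/
theorem postB_relL_s_nonneg : ∀ i : Fin 3, 0 ≤ postB_relL.s i := by decide +kernel

/-- All `c_i > 0`. -/
theorem postB_relL_c_pos : ∀ i : Fin 3, 0 < postB_relL.c i := by decide +kernel

/-- The reference angle is `0`. -/
theorem postB_relL_angleOf_zero : postB_relL.angleOf 0 = 0 :=
  postB_relL.angleOf_eq_zero (by decide +kernel) (by decide +kernel)

/-- **Certified lower node-angle bounds** for `postB_relL`. -/
theorem angleLo_le : ∀ i : Fin 3, ((angleLo i : ℚ) : ℝ) ≤ postB_relL.angleOf i :=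
  postB_relL.table_le_angleOf postB_relL_circle.1 postB_relL_s_nonneg angleLo (by decide +kernel)

/-- **Certified upper node-angle bounds** for `postB_relL`. -/
theorem angleOf_le_angleHi : ∀ i : Fin 3, postB_relL.angleOf i ≤ ((angleHi i : ℚ) : ℝ) :=
  postB_relL.angleOf_le_table postB_relL_circle.1 postB_relL_s_nonneg angleHi (by decide +kernel)

/-- Every line angle of `postB_relL` lies in `(−π/2, π/2)`. -/
theorem postB_relL_abs_angleOf_sub_lt (a b : Fin 3) : |postB_relL.angleOf a - postB_relL.angleOf b| < π / 2 :=
  postB_relL.abs_angleOf_sub_lt_pi_div_two (postB_relL_s_nonneg a) (postB_relL_s_nonneg b)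
    (postB_relL_c_pos a) (postB_relL_c_pos b)

/-! ### «WSCC9 lossless variant»: λ-free aggregates -/

/-- `Σ_pairs (C_ij/2)·eqTermHi ≤ 72029/20000` (`= 3.60145`; exact `≈ 3.6014485`). -/
theorem eqTermHi_sum_pair_le :
    (∑ k : RecastData.LffPair 2, postB_relL.Cc k.1.1 k.1.2 / 2 * postB_relL.eqTermHi angleLo angleHi k.1.1 k.1.2)
      ≤ (72029 : ℚ) / 20000 := by
  decide +kernel

/-- `Σ_lines C_ij·eqTermHi ≤ 72029/20000`. -/
theorem eqTermHi_sum_line_le :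
    (∑ k : RecastData.LffLine 2, postB_relL.Cc k.1.1 k.1.2 * postB_relL.eqTermHi angleLo angleHi k.1.1 k.1.2)
      ≤ (72029 : ℚ) / 20000 := by
  decide +kernel

/-- `(C_ij/2)·vtGapLo ≥ 1657/10000` on every ordered pair (minimum `≈ 0.1657818`). -/
theorem vtGapLo_pair_ge : ∀ k : RecastData.LffPair 2,
    (1657 : ℚ) / 10000 ≤ postB_relL.Cc k.1.1 k.1.2 / 2 * postB_relL.vtGapLo angleLo angleHi k.1.1 k.1.2 := by
  decide +kernel

/-- `C_ij·vtGapLo ≥ 3315/10000` on every unordered line. -/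
theorem vtGapLo_line_ge : ∀ k : RecastData.LffLine 2,
    (3315 : ℚ) / 10000 ≤ postB_relL.Cc k.1.1 k.1.2 * postB_relL.vtGapLo angleLo angleHi k.1.1 k.1.2 := by
  decide +kernel

/-- **CERTIFIED (pairs, `w = C_ij/2`):** `Σ_k w_k (cos δ*_k + δ*_k sin δ*_k) ≤ 72029/20000`. -/
theorem sum_lffWo_eqTerm_le :
    ∑ k : RecastData.LffPair 2, postB_relL.lffWo k *
        (cos (RecastData.lffδso postB_relL.angleOf k)
          + RecastData.lffδso postB_relL.angleOf k * sin (RecastData.lffδso postB_relL.angleOf k))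
      ≤ (72029 : ℝ) / 20000 := by
  have h := postB_relL.sum_w_eqTerm_le_pair postB_relL_eqData postB_relL_c_pos angleLo_le angleOf_le_angleHi
    (fun k => postB_relL.Cc k.1.1 k.1.2 / 2)
    (fun k => by have := postB_relL_Cc_pos k.1.1 k.1.2 k.2; positivity)
  have hq := (Rat.cast_le (K := ℝ)).mpr eqTermHi_sum_pair_le
  have e : ∀ k : RecastData.LffPair 2, postB_relL.lffWo k = ((postB_relL.Cc k.1.1 k.1.2 / 2 : ℚ) : ℝ) :=
    fun k => by push_cast; rfl
  simp_rw [e]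
  push_cast at h hq ⊢
  linarith

/-- **CERTIFIED (pairs):** `1657/10000 ≤ w_k · vtGap(δ*_k)` on every ordered pair. -/
theorem lffWo_vtGap_ge (k : RecastData.LffPair 2) :
    (1657 : ℝ) / 10000 ≤ postB_relL.lffWo k * vtGap (RecastData.lffδso postB_relL.angleOf k) := by
  have h1 := postB_relL.vtGapLo_le_pair postB_relL_eqData postB_relL_c_pos angleLo_le angleOf_le_angleHi k
  have h2 := (Rat.cast_le (K := ℝ)).mpr (vtGapLo_pair_ge k)
  have hw : (0 : ℝ) ≤ (postB_relL.Cc k.1.1 k.1.2 : ℝ) / 2 := by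
    have := postB_relL_Cc_pos k.1.1 k.1.2 k.2; positivity
  have e : postB_relL.lffWo k = (postB_relL.Cc k.1.1 k.1.2 : ℝ) / 2 := rfl
  rw [e]
  push_cast at h2
  exact h2.trans (mul_le_mul_of_nonneg_left h1 hw)

/-- **CERTIFIED (lines, `w = C_ij`):** `Σ_k w_k (cos δ*_k + δ*_k sin δ*_k) ≤ 72029/20000`. -/
theorem sum_lffWu_eqTerm_le :
    ∑ k : RecastData.LffLine 2, postB_relL.lffWu k *
        (cos (RecastData.lffδsu postB_relL.angleOf k)
          + RecastData.lffδsu postB_relL.angleOf k * sin (RecastData.lffδsu postB_relL.angleOf k))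
      ≤ (72029 : ℝ) / 20000 := by
  have h := postB_relL.sum_w_eqTerm_le_line postB_relL_eqData postB_relL_c_pos angleLo_le angleOf_le_angleHi
    (fun k => postB_relL.Cc k.1.1 k.1.2) (fun k => (postB_relL_Cc_pos k.1.1 k.1.2 (ne_of_lt k.2)).le)
  have hq := (Rat.cast_le (K := ℝ)).mpr eqTermHi_sum_line_le
  have e : ∀ k : RecastData.LffLine 2, postB_relL.lffWu k = ((postB_relL.Cc k.1.1 k.1.2 : ℚ) : ℝ) :=
    fun k => rfl
  simp_rw [e]
  push_cast at h hq ⊢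
  linarith

/-- **CERTIFIED (lines):** `3315/10000 ≤ w_k · vtGap(δ*_k)` on every unordered line. -/
theorem lffWu_vtGap_ge (k : RecastData.LffLine 2) :
    (3315 : ℝ) / 10000 ≤ postB_relL.lffWu k * vtGap (RecastData.lffδsu postB_relL.angleOf k) := by
  have h1 := postB_relL.vtGapLo_le_line postB_relL_eqData postB_relL_c_pos angleLo_le angleOf_le_angleHi k
  have h2 := (Rat.cast_le (K := ℝ)).mpr (vtGapLo_line_ge k)
  have hw : (0 : ℝ) ≤ (postB_relL.Cc k.1.1 k.1.2 : ℝ) := by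
    exact_mod_cast (postB_relL_Cc_pos k.1.1 k.1.2 (ne_of_lt k.2)).le
  have e : postB_relL.lffWu k = (postB_relL.Cc k.1.1 k.1.2 : ℝ) := rfl
  rw [e]
  push_cast at h2
  exact h2.trans (mul_le_mul_of_nonneg_left h1 hw)

/-- **THE EXPLICIT-LEVEL INEQUALITY, pairs** (lyap-1's P1 `WSCC9LffRoa` p487113 is on `lffSystemOff`):
for every `c′ ≥ 0` and every ordered pair `k`,
`c′·(1657/10000 − 72029/20000) ≤ −Σ c′·w (cos δ* + δ* sin δ*) + c′·w_k·vtGap(δ*_k)`; so every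
`c₀ < −c′ · 3.43575` is admissible; at `λ = 1/10` (`c′ = 401/20`): every `c₀ ≤ −68.89`. -/
theorem closedForm_level_pair (cp : ℝ) (hcp : 0 ≤ cp) (k : RecastData.LffPair 2) :
    cp * ((1657 : ℝ) / 10000 - 72029 / 20000)
      ≤ -(∑ k' : RecastData.LffPair 2, cp * postB_relL.lffWo k' *
            (cos (RecastData.lffδso postB_relL.angleOf k')
              + RecastData.lffδso postB_relL.angleOf k' * sin (RecastData.lffδso postB_relL.angleOf k')))
        + cp * postB_relL.lffWo k * vtGap (RecastData.lffδso postB_relL.angleOf k) := by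
  have h1 := sum_lffWo_eqTerm_le
  have h2 := lffWo_vtGap_ge k
  have e : ∑ k' : RecastData.LffPair 2, cp * postB_relL.lffWo k' *
            (cos (RecastData.lffδso postB_relL.angleOf k')
              + RecastData.lffδso postB_relL.angleOf k' * sin (RecastData.lffδso postB_relL.angleOf k'))
      = cp * ∑ k' : RecastData.LffPair 2, postB_relL.lffWo k' *
            (cos (RecastData.lffδso postB_relL.angleOf k')
              + RecastData.lffδso postB_relL.angleOf k' * sin (RecastData.lffδso postB_relL.angleOf k')) := by
    rw [Finset.mul_sum]
    exact Finset.sum_congr rfl fun _ _ => by ring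
  rw [e]
  nlinarith

/-- **THE EXPLICIT-LEVEL INEQUALITY, lines** (`WSCC9.lffSystemU`): at `λ = 1/10` every `c₀ ≤ −65.57`. -/
theorem closedForm_level_line (cp : ℝ) (hcp : 0 ≤ cp) (k : RecastData.LffLine 2) :
    cp * ((3315 : ℝ) / 10000 - 72029 / 20000)
      ≤ -(∑ k' : RecastData.LffLine 2, cp * postB_relL.lffWu k' *
            (cos (RecastData.lffδsu postB_relL.angleOf k')
              + RecastData.lffδsu postB_relL.angleOf k' * sin (RecastData.lffδsu postB_relL.angleOf k')))
        + cp * postB_relL.lffWu k * vtGap (RecastData.lffδsu postB_relL.angleOf k) := by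
  have h1 := sum_lffWu_eqTerm_le
  have h2 := lffWu_vtGap_ge k
  have e : ∑ k' : RecastData.LffLine 2, cp * postB_relL.lffWu k' *
            (cos (RecastData.lffδsu postB_relL.angleOf k')
              + RecastData.lffδsu postB_relL.angleOf k' * sin (RecastData.lffδsu postB_relL.angleOf k'))
      = cp * ∑ k' : RecastData.LffLine 2, postB_relL.lffWu k' *
            (cos (RecastData.lffδsu postB_relL.angleOf k')
              + RecastData.lffδsu postB_relL.angleOf k' * sin (RecastData.lffδsu postB_relL.angleOf k')) := by
    rw [Finset.mul_sum]
    exact Finset.sum_congr rfl fun _ _ => by ring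
  rw [e]
  nlinarith

end WSCC9

end Summit.Ventures.GridStability.Models

end
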